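import Summits.CriticalPhenomena.PercolationContinuityZ3.Theorems.PercNearOneGluingNoHeavyLowerTailCILOwnEdgeStability
import HarnessLib

/-!
# `NoHeavyLowerTail` (stmt-CriticalPhenomena-4575) — raising a pair AT a relay preserves every other relay's lead over it,
# from ANY starting weight

Support file (prover `prim-lf-3`, lemma factory #3; `--supports stmt-CriticalPhenomena-4575 --as helper`).  No definitions, no named
facts, no sorries.

Notation: `μ_w = prodBernoulli w`, relays `A`, level `j`, lightness `I_w(x) = μ_w{|π(x)| ≤ j}`.  `CutObserver.lightness_glued_le` (own-edge
stability file) says: for a pair `e = s(a, v)` at `a` and a relay `x ≠ a`, if `I_{w[e↦0]}(a) ≤ I_{w[e↦0]}(x)` then `I_{w[e↦1]}(a) ≤ I_{w[e↦1]}(x)`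
— the hypothesis is at weight ZERO.  Here the hypothesis is taken at the CURRENT weight of `e`:

* `CutObserver.lightness_raise_le` — if `I_w(a) ≤ I_w(x)` then `I_{w[s(a,v)↦1]}(a) ≤ I_{w[s(a,v)↦1]}(x)`.

Proof: `t ↦ I_{w[e↦t]}(x) − I_{w[e↦t]}(a)` is affine (`stub_oneBondDecomp_k15`); if it is `≥ 0` at `t = 0` use `lightness_glued_le`;
otherwise it is `< 0` at `0` and `≥ 0` at `t = w e`, hence increasing, hence `≥ 0` at `t = 1`.  So a relay that is ahead of `a` in the
ACTUAL graph stays ahead after gluing any pair at `a` (e.g. a port-pair of a Steiner arm): the 'short-circuit at the loser' monotonicity used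
in the lemma-factory memo LF3-RNCS.md §5(c) (vertex `S = P_x` of the coin cube) without a weight-0 hypothesis.
-/

noncomputable section

namespace Summit.CriticalPhenomena.PercolationContinuityZ3.Theorems

open MeasureTheory Set Literature.Probability.LatticeModels Literature.Probability.Percolation
open scoped Classical BigOperators

variable {n : ℕ}

namespace CutObserver

/-- **Raising a pair at `a` preserves `x`'s lead over `a`, from any weight.**  For `a ≠ v`, `x ≠ a`: if
`μ_w{|π(a)| ≤ j} ≤ μ_w{|π(x)| ≤ j}` then the same holds under `w[s(a,v) ↦ 1]`. [this file] -/
theorem lightness_raise_le (w : Sym2 (Fin n) → unitInterval) (A : Finset (Fin n)) (a v x : Fin n) (j : ℕ)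
    (hav : a ≠ v) (hxa : x ≠ a)
    (hle : (prodBernoulli w).real {ω : BondConfig (Fin n) | (A.filter fun z => ω ∈ openConn a z).card ≤ j} ≤
      (prodBernoulli w).real {ω : BondConfig (Fin n) | (A.filter fun z => ω ∈ openConn x z).card ≤ j}) :
    (prodBernoulli (Function.update w s(a, v) 1)).real
        {ω : BondConfig (Fin n) | (A.filter fun z => ω ∈ openConn a z).card ≤ j} ≤
      (prodBernoulli (Function.update w s(a, v) 1)).real
        {ω : BondConfig (Fin n) | (A.filter fun z => ω ∈ openConn x z).card ≤ j} := by
  set e : Sym2 (Fin n) := s(a, v) with he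
  set w₀ := Function.update w e 0 with hw₀
  set w₁ := Function.update w e 1 with hw₁
  set Ra : Set (BondConfig (Fin n)) := {ω : BondConfig (Fin n) | (A.filter fun z => ω ∈ openConn a z).card ≤ j}
    with hRa
  set Rx : Set (BondConfig (Fin n)) := {ω : BondConfig (Fin n) | (A.filter fun z => ω ∈ openConn x z).card ≤ j}
    with hRx
  by_cases h0 : (prodBernoulli w₀).real Ra ≤ (prodBernoulli w₀).real Rx
  · -- hypothesis already at weight 0: glued comparison
    have hw0e : w₀ s(a, v) = 0 := by rw [← he, hw₀, Function.update_self]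
    have hw1' : w₁ = Function.update w₀ s(a, v) 1 := by rw [hw₁, hw₀, ← he, Function.update_idem]
    rw [hw1']
    exact lightness_glued_le w₀ A a v x j hav hxa hw0e h0
  · -- otherwise the affine function t ↦ I_t(x) − I_t(a) is negative at 0, nonnegative at t = w e, hence ≥ 0 at 1
    push Not at h0
    have hp0 : 0 ≤ (w e : ℝ) := (w e).2.1
    have hp1 : (w e : ℝ) ≤ 1 := (w e).2.2
    have hda := stub_oneBondDecomp_k15 n w e Ra
    have hdx := stub_oneBondDecomp_k15 n w e Rx
    -- from hle and the decompositions: (w e)·(I₁(x) − I₁(a)) ≥ (1 − w e)·(I₀(a) − I₀(x)) > 0 unless w e = ... ;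
    -- in all cases (w e)·(I₁(x) − I₁(a)) ≥ 0 with w e > 0 forced by h0 and hle.
    have hwe_pos : 0 < (w e : ℝ) := by
      by_contra hle0
      push Not at hle0
      have hz : (w e : ℝ) = 0 := le_antisymm hle0 hp0
      rw [hda, hdx, hz] at hle
      simp only [sub_zero, one_mul, zero_mul, add_zero] at hle
      exact absurd hle (not_le.mpr h0)
    have key : (w e : ℝ) * ((prodBernoulli w₁).real Rx - (prodBernoulli w₁).real Ra) ≥
        (1 - (w e : ℝ)) * ((prodBernoulli w₀).real Ra - (prodBernoulli w₀).real Rx) := by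
      rw [hda, hdx] at hle; linarith
    have key2 : 0 ≤ (w e : ℝ) * ((prodBernoulli w₁).real Rx - (prodBernoulli w₁).real Ra) :=
      le_trans (mul_nonneg (by linarith) (by linarith)) key
    have : 0 ≤ (prodBernoulli w₁).real Rx - (prodBernoulli w₁).real Ra := by
      by_contra hneg
      push Not at hneg
      have : (w e : ℝ) * ((prodBernoulli w₁).real Rx - (prodBernoulli w₁).real Ra) < 0 := mul_neg_of_pos_of_neg hwe_pos hneg
      linarith
    linarith

end CutObserver

end Summit.CriticalPhenomena.PercolationContinuityZ3.Theorems

end
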